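import Summits.AtomisticToContinuum.HydrodynamicLimit.Theses.RelayRaceLocality
import Literature.Analysis.FunctionSpaces.TorusSpaceTime
import Literature.Analysis.FunctionSpaces.TorusCalculusProofs
import Literature.Analysis.FluidPDE.TorusHeatForcedIcc
import HarnessLib

/-!
# Crux `RestartPrinciple` (stmt-AtomisticToContinuum-12503), line `Sketch` — stub `stub_solutionShift`

Support file for the crux `Summit.AtomisticToContinuum.HydrodynamicLimit.Theses.RelayRaceLocality.RestartPrinciple`
(route `RelayRaceLocality`), line `Sketch`: the ELEMENTARY time-shift stub of the restart
induction. The hard-sphere compressible Euler system is autonomous, so a classical solution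
`IsHardSphereEulerSolution σ T ρ u θ` on `[0, T) × 𝕋³`, restarted at a time `s₀ ≥ 0`, i.e. the
shifted fields `t ↦ (ρ, u, θ)(s₀ + t)`, is again a classical solution, on `[0, T - s₀) × 𝕋³`
(void unless `s₀ < T`).

Proof: joint smoothness translates in time (`Torus.IsSmoothSpaceTimeOn.comp_add_const`) and
restricts from `(· + s₀)⁻¹' [0, T) ⊇ [0, T - s₀)` (`Torus.IsSmoothSpaceTimeOn.mono`); positivity
and the spatial terms of the three conservation laws at time `t` are literally those of the given
solution at time `s₀ + t`; the one-sided time derivative within `[0, T - s₀)` of a shifted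
conserved density (each jointly smooth on `[0, T) × 𝕋³`: `ρ`, `ρu`, `ρ(|u|²/2 + 3θ/2)`) at `t` is
the one-sided time derivative within `[0, T)` of the density at `s₀ + t`
(`Torus.IsSmoothSpaceTimeOn.hasDerivWithinAt_slice` on the translated time set,
`Torus.timeDerivWithin_comp_add_const`, `HasDerivWithinAt.mono`, `uniqueDiffOn_Ico`) — at `t = 0`,
`s₀ > 0` this uses the differentiability of the smooth slice at the interior time `s₀`.
-/

noncomputable section

open Literature.MathematicalPhysics.KineticTheory Literature.Analysis.FluidPDE
open Literature.Analysis.FunctionSpaces MeasureTheory Filter Set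
open Summit.AtomisticToContinuum.HydrodynamicLimit.Theses.RelayRaceLocality
open scoped ContDiff

namespace Summit.AtomisticToContinuum.HydrodynamicLimit.Theorems.RestartPrinciple

/-- For `s₀ ≥ 0`, the time set `[0, T - s₀)` translated by `s₀` lies in `[0, T)`:
`[0, T - s₀) ⊆ (· + s₀)⁻¹' [0, T)`. [folklore] -/
private theorem Ico_subset_preimage_add_Ico {T s₀ : ℝ} (hs₀ : 0 ≤ s₀) :
    Ico 0 (T - s₀) ⊆ (· + s₀) ⁻¹' Ico 0 T := fun _t ht =>
  ⟨by linarith [ht.1], by linarith [ht.2]⟩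

/-- Joint smoothness on `[0, T) × 𝕋³` passes to the field shifted in time by `s₀ ≥ 0`, on
`[0, T - s₀) × 𝕋³` (`Torus.IsSmoothSpaceTimeOn.comp_add_const`, `Torus.IsSmoothSpaceTimeOn.mono`).
[folklore] -/
private theorem isSmoothSpaceTimeOn_shift {F : Type*} [NormedAddCommGroup F] [NormedSpace ℝ F]
    {T s₀ : ℝ} (hs₀ : 0 ≤ s₀) {f : ℝ → T3 → F} (hf : Torus.IsSmoothSpaceTimeOn (Ico 0 T) f) :
    Torus.IsSmoothSpaceTimeOn (Ico 0 (T - s₀)) (fun t => f (s₀ + t)) := by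
  have heq : (fun t => f (s₀ + t)) = fun t => f (t + s₀) := by
    funext t
    rw [add_comm]
  rw [heq]
  exact (hf.comp_add_const s₀).mono (Ico_subset_preimage_add_Ico hs₀)

/-- The one-sided time derivative within `[0, T - s₀)` of a field shifted in time by `s₀ ≥ 0`,
the field being jointly smooth on `[0, T) × 𝕋³`, is the one-sided time derivative within `[0, T)`
of the field at the shifted time: the shifted slice is differentiable within the translated time
set `(· + s₀)⁻¹' [0, T) ⊇ [0, T - s₀)` with derivative `∂ₜf (s₀ + t)`
(`Torus.IsSmoothSpaceTimeOn.hasDerivWithinAt_slice`, `Torus.timeDerivWithin_comp_add_const`), and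
`[0, T - s₀)` is a set of unique differentiability (`uniqueDiffOn_Ico`). [folklore] -/
private theorem timeDerivWithin_shift {F : Type*} [NormedAddCommGroup F] [NormedSpace ℝ F]
    {T s₀ : ℝ} (hs₀ : 0 ≤ s₀) {f : ℝ → T3 → F} (hf : Torus.IsSmoothSpaceTimeOn (Ico 0 T) f)
    {t : ℝ} (ht : t ∈ Ico 0 (T - s₀)) (x : T3) :
    Torus.timeDerivWithin (Ico 0 (T - s₀)) (fun τ => f (s₀ + τ)) t x =
      Torus.timeDerivWithin (Ico 0 T) f (s₀ + t) x := by
  have hsub : Ico 0 (T - s₀) ⊆ (· + s₀) ⁻¹' Ico 0 T := Ico_subset_preimage_add_Ico hs₀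
  -- the translated slice is differentiable within the small time set, derivative `∂ₜf (t + s₀)`
  have h1 : HasDerivWithinAt (fun τ => f (τ + s₀) x)
      (Torus.timeDerivWithin (Ico 0 T) f (t + s₀) x) (Ico 0 (T - s₀)) t := by
    have h := ((hf.comp_add_const s₀).hasDerivWithinAt_slice (hsub ht) x).mono hsub
    rwa [Torus.timeDerivWithin_comp_add_const] at h
  have heq : (fun τ => f (s₀ + τ)) = fun τ => f (τ + s₀) := by
    funext τ
    rw [add_comm]
  rw [heq, add_comm s₀ t]
  exact h1.derivWithin (uniqueDiffOn_Ico 0 (T - s₀) t ht)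

/-- **Time shift of a classical hard-sphere Euler solution.** If `(ρ, u, θ)` is a classical
solution of the hard-sphere compressible Euler system on `[0, T) × 𝕋³`
(`IsHardSphereEulerSolution σ T ρ u θ`) and `s₀ ≥ 0`, then the shifted fields
`t ↦ (ρ, u, θ)(s₀ + t)` form a classical solution on `[0, T - s₀) × 𝕋³` (the system is
autonomous: smoothness, positivity and the spatial terms translate literally, and the one-sided
time derivatives within `[0, T - s₀)` of the shifted conserved densities `ρ`, `ρu`,
`ρ(|u|²/2 + 3θ/2)` are those within `[0, T)` at the shifted time). [folklore] -/
theorem stub_solutionShift :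
    ∀ (σ T : ℝ) (ρ θ : ℝ → T3 → ℝ) (u : ℝ → T3 → V3), IsHardSphereEulerSolution σ T ρ u θ →
      ∀ s₀ : ℝ, 0 ≤ s₀ →
        IsHardSphereEulerSolution σ (T - s₀) (fun t => ρ (s₀ + t)) (fun t => u (s₀ + t))
          (fun t => θ (s₀ + t)) := by
  intro σ T ρ θ u hsol s₀ hs₀
  have hmem : ∀ t ∈ Ico 0 (T - s₀), s₀ + t ∈ Ico 0 T := fun t ht =>
    ⟨by linarith [ht.1], by linarith [ht.2]⟩
  -- the momentum and energy densities are jointly smooth on `[0, T) × 𝕋³`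
  have hm : Torus.IsSmoothSpaceTimeOn (Ico 0 T) (fun s y => ρ s y • u s y) :=
    hsol.smooth_density.smul hsol.smooth_velocity
  have hE : Torus.IsSmoothSpaceTimeOn (Ico 0 T)
      (fun s y => totalEnergyDensity (ρ s y) (u s y) (θ s y)) := by
    have hρ := hsol.smooth_density
    have hu := hsol.smooth_velocity
    have hθ := hsol.smooth_temperature
    unfold Torus.IsSmoothSpaceTimeOn at hρ hu hθ ⊢
    change ContDiffOn ℝ ∞ (fun z => Torus.stLift ρ z *
      (‖Torus.stLift u z‖ ^ 2 / 2 + 3 / 2 * Torus.stLift θ z)) (Ico 0 T ×ˢ univ)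
    exact hρ.mul (((hu.norm_sq ℝ).div_const 2).add (contDiffOn_const.mul hθ))
  exact
    { smooth_density := isSmoothSpaceTimeOn_shift hs₀ hsol.smooth_density
      smooth_velocity := isSmoothSpaceTimeOn_shift hs₀ hsol.smooth_velocity
      smooth_temperature := isSmoothSpaceTimeOn_shift hs₀ hsol.smooth_temperature
      density_pos := fun t ht x => hsol.density_pos (s₀ + t) (hmem t ht) x
      temperature_pos := fun t ht x => hsol.temperature_pos (s₀ + t) (hmem t ht) x
      mass := fun t ht x => by
        rw [timeDerivWithin_shift hs₀ hsol.smooth_density ht x]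
        exact hsol.mass (s₀ + t) (hmem t ht) x
      momentum := fun t ht x => by
        have key := timeDerivWithin_shift hs₀ hm ht x
        rw [key]
        exact hsol.momentum (s₀ + t) (hmem t ht) x
      energy := fun t ht x => by
        have key := timeDerivWithin_shift hs₀ hE ht x
        rw [key]
        exact hsol.energy (s₀ + t) (hmem t ht) x }

end Summit.AtomisticToContinuum.HydrodynamicLimit.Theorems.RestartPrinciple

end
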